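import Summits.BirchSwinnertonDyer.BirchSwinnertonDyer.Theorems.CMKolyvaginAtInertTwoPairSupplyCompositeAtTwo
import Summits.BirchSwinnertonDyer.BirchSwinnertonDyer.Theses.CMKolyvaginAtInertTwo
import HarnessLib

/-!
# Route `CMKolyvaginAtInertTwo`, crux `CMKolyvaginExactAtInertTwo` (stmt-BirchSwinnertonDyer-24277) —
# TWO CONSEQUENCES OF THE GENUS DEFECT `Σ` (what the count identity alone forces on H₂ for composite `d_K`)

Seat `bsd-line-cmk2-p1` g20 (cell `bsd-print-cf2`), `--supports stmt-BirchSwinnertonDyer-24277` (helper;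
closes nothing).  THEOREMS ONLY (no definition, no named fact, no `sorry`).  BSD is NOT proved by this.

`Σ := Σ_{q ∣ d_K} ([(Δ/q) = −1] + 2·[(Δ/q) = 1 ∧ a_q even]) = Σ_q log₂ #E(ℚ_q)[2] = ord₂ ∏_{q∣d_K} c_q(E^{(d_K)})`
(g15).  g15's count identity (`ShaCountTwo.card_primaryComponent_sha_two_baseChange_mul_two_eq_of_heegnerData_of_facts`,
modulo Gross–Zagier all levels, GZK, modularity, Milne any-model) reads on H₂ (`Δ < 0`):
`#Ш(E_K)(2) · 2 = #Ш(E)(2) · #Ш(E^{(d_K)})(2) · 2^{Σ}`.  Hence: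

* `two_pow_sum_defect_le_card_sha_two_baseChange_mul_two` — **`2^{Σ} ≤ #Ш(E_K)(2) · 2`** on every H₂ frame
  (`y_K` of infinite order): for `Σ ≥ 2`, `Ш(E/K)[2] ≠ 0` is FORCED by genus theory, whatever `y_K` does.
* `sum_defect_le_of_cmKolyvaginExact` — **the hidden content of the crux for composite `d_K`**: the route
  Prop `CMKolyvaginExactAtInertTwo` (stmt 24277) together with the four prints implies, for every frame of
  its own hypotheses carrying a primitive certificate, **`Σ ≤ 2·M₀ + 1`**; in particular
  (`sum_defect_le_one_of_cmKolyvaginExact_of_not_two_dvd`, certificate `n = 1`) **if `y_K ∉ 2E(K[1])` then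
  `Σ ≤ 1`** — on a Heegner field with two «non-`C₃`» primes the crux asserts that `y_K` IS `2`-divisible
  (a genus divisibility of the Heegner point, BSD-consistent: BSD(E/K)₂ reads `ord₂ #Ш(E_K) = 2M₀` with
  `#Ш(E_K)(2) ≥ 2^{Σ−1}`).  Memo `Cruxes/CMExactDescentAtTwo/MEMO-genus-triviality.md` §4–§7.

References: [GrossLMS1991] Conj. 1.2 (p. 276), Prop. 2.1; [Kramer1981] Prop. 3, Thm. 1; [Milne1972] Thm. 1;
[McCallumLMS1991] §5 Thm. 5.4.
-/

set_option autoImplicit false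
-- the Theorems namespace of this sub repeats the summit name by design (D-0017 nested layout)
set_option linter.dupNamespace false

noncomputable section

open scoped Classical

namespace Summit.BirchSwinnertonDyer.BirchSwinnertonDyer.Theorems.KolyvaginGenusTwo

open WeierstrassCurve NumberField IsDedekindDomain Field
open Literature.NumberTheory.EllipticCurves Literature.NumberTheory.GaloisRepresentations
open Literature.NumberTheory.EllipticCurves.ModularForms Literature.NumberTheory.EllipticCurves.RingClassField
open Summit.BirchSwinnertonDyer.BirchSwinnertonDyer.Theses.CMKolyvaginAtInertTwo (CMKolyvaginExactAtInertTwo)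

variable (W : WeierstrassCurve ℚ) {K : Type} [Field K] [NumberField K]

/-- **`2^{Σ} ≤ #Ш(E_K)(2) · 2` ON H₂** (CM, `2` inert in the CM field, `ρ̄_{E,2}` onto; `K` imaginary
quadratic with odd `d_K` and the Heegner hypothesis; a frame `(Dt, β, ι, d₁)` with `y_K` of infinite order),
modulo Gross–Zagier (all levels), GZK, modularity and Milne any-model: g15's count identity with both `ℚ`-side
Ш-parts `≥ 1` (finite by GZ/GZK/modularity). [cite: Milne1972ArithmeticAV, Thm. 1] [cite: Kramer1981, Prop. 3]
[cite: GrossZagier1986, I (6.3)] -/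
theorem two_pow_sum_defect_le_card_sha_two_baseChange_mul_two
    (hGZ : ∀ (N : ℕ) [NeZero N] (W : WeierstrassCurve ℚ) (K : Type) [Field K] [NumberField K], gross_zagier N W K)
    (hGZK : rank_eq_analyticRank_of_analyticRank_le_one) (hmod : hasEntireLFunction_rat)
    (hMilneC : Milne1972.bsdQuotient_baseChange_quadratic_anyModel)
    [W.IsElliptic] [W.IsGloballyMinimal] [NeZero (W.conductorNorm ℤ)]
    (hCM : W.HasCM) (hin : Literature.NumberTheory.EllipticCurves.Rank1Residual.CMInert W 2)
    (hρ : W.HasSurjectiveModNGaloisRep 2) (hK : IsImaginaryQuadratic K)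
    (hoddK : Odd (NumberField.discr K)) (hH : SatisfiesHeegnerHypothesis (W.conductorNorm ℤ) K)
    (Dt : ModularParametrizationData W (W.conductorNorm ℤ)) (β : ℤ) (ιK : K →+* ℂ) (d₁ : KolyvaginHeegnerData Dt β ιK 1)
    (hy : ¬ IsOfFinAddOrder d₁.derivedPoint) :
    2 ^ ∑ q ∈ (NumberField.discr K).natAbs.primeFactors,
        ((if jacobiSym W.Δ.num q = -1 then 1 else 0) +
          (if jacobiSym W.Δ.num q = 1 ∧ Even (W.frobeniusTrace q) then 2 else 0)) ≤
      Nat.card (AddCommGroup.primaryComponent (W.baseChange K).sha 2) * 2 := by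
  obtain ⟨-, hid⟩ := ShaCountTwo.card_primaryComponent_sha_two_baseChange_mul_two_eq_of_heegnerData_of_facts hGZ hGZK hmod
    hMilneC W hρ K hK hoddK hH Dt β ιK d₁ hy
  have hΔ : ¬ 0 < W.Δ := not_lt.mpr (KolyvaginEigenTwo.Δ_neg_of_cmInert_two W hCM hin hρ).le
  rw [hid, if_neg hΔ, one_mul]
  -- both `ℚ`-side Ш-parts are finite, hence of cardinality `≥ 1`
  have hD0 : (NumberField.discr K : ℚ) ≠ 0 := by exact_mod_cast NumberField.discr_ne_zero K
  haveI hEt : (W.quadraticTwist (NumberField.discr K : ℚ)).IsElliptic := W.isElliptic_quadraticTwist hD0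
  obtain ⟨-, hfinW, hfinD⟩ := ShaCountTwo.rank_add_eq_one_and_finite_sha_of_heegnerData_of_facts hGZ hGZK hmod W K hK hH
    Dt β ιK d₁ hy (W.quadraticTwist (NumberField.discr K : ℚ)) ⟨1, one_smul _ _⟩
  haveI := hfinW
  haveI := hfinD
  have h1 : 1 ≤ Nat.card (AddCommGroup.primaryComponent W.sha 2) := Nat.card_pos
  have h2 : 1 ≤ Nat.card (AddCommGroup.primaryComponent (W.quadraticTwist (NumberField.discr K : ℚ)).sha 2) := Nat.card_pos
  calc 2 ^ _ = 1 * 1 * 2 ^ ∑ q ∈ (NumberField.discr K).natAbs.primeFactors,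
        ((if jacobiSym W.Δ.num q = -1 then 1 else 0) +
          (if jacobiSym W.Δ.num q = 1 ∧ Even (W.frobeniusTrace q) then 2 else 0)) := by rw [one_mul, one_mul]
    _ ≤ _ := Nat.mul_le_mul_right _ (Nat.mul_le_mul h1 h2)

/-- **THE HIDDEN CONTENT OF CRUX 24277 FOR COMPOSITE `d_K`: `Σ ≤ 2M₀ + 1`.**  The route Prop
`CMKolyvaginExactAtInertTwo`, applied to a frame of its own hypotheses with a primitive certificate `(n, d)`,
gives `#Ш(E_K)(2) = 2^{2M₀}`; with `2^{Σ} ≤ #Ш(E_K)(2)·2` (count identity) this forces `Σ ≤ 2M₀ + 1`: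
whenever `d_K` has many primes `q` with `E(ℚ_q)[2] ≠ 0`, the Heegner point must be highly `2`-divisible.
Conditional on the crux (hypothesis `hX`) and the four prints; closes nothing.
[cite: McCallumLMS1991, §5 Thm. 5.4] [cite: GrossLMS1991, Conj. 1.2 (p. 276)] [cite: Kramer1981, Prop. 3] -/
theorem sum_defect_le_of_cmKolyvaginExact (hX : CMKolyvaginExactAtInertTwo)
    (hGZ : ∀ (N : ℕ) [NeZero N] (W : WeierstrassCurve ℚ) (K : Type) [Field K] [NumberField K], gross_zagier N W K)
    (hGZK : rank_eq_analyticRank_of_analyticRank_le_one) (hmod : hasEntireLFunction_rat)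
    (hMilneC : Milne1972.bsdQuotient_baseChange_quadratic_anyModel)
    [W.IsElliptic] [W.IsGloballyMinimal] [NeZero (W.conductorNorm ℤ)]
    (hCM : W.HasCM) (hin : Literature.NumberTheory.EllipticCurves.Rank1Residual.CMInert W 2)
    (hρ : W.HasSurjectiveModNGaloisRep 2) (hT : Odd W.tamagawaProduct) (hK : IsImaginaryQuadratic K)
    (hoddK : Odd (NumberField.discr K)) (h3 : NumberField.discr K ≠ -3)
    (hH : SatisfiesHeegnerHypothesis (W.conductorNorm ℤ) K)
    (hns₁ : ¬ IsSquare ((NumberField.discr K : ℚ) * -|W.Δ|)) (hns₂ : ¬ IsSquare ((NumberField.discr K : ℚ) * (-(2 * |W.Δ|))))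
    (Dt : ModularParametrizationData W (W.conductorNorm ℤ)) (β : ℤ) (ιK : K →+* ℂ) (d₁ : KolyvaginHeegnerData Dt β ιK 1)
    (hy : ¬ IsOfFinAddOrder d₁.derivedPoint) (M₀ : ℕ)
    (hdiv : ∃ Q : (W.baseChange (ringClassField K ιK 1)).toAffine.Point, ((2 ^ M₀ : ℕ) : ℤ) • Q = d₁.derivedPoint)
    (hndiv : ¬ ∃ Q : (W.baseChange (ringClassField K ιK 1)).toAffine.Point, ((2 ^ (M₀ + 1) : ℕ) : ℤ) • Q = d₁.derivedPoint)
    {n : ℕ} (d : KolyvaginHeegnerData Dt β ιK n) (hn : Squarefree n)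
    (hKoly : ∀ ℓ ∈ n.primeFactors, Zhang2014.IsKolyvaginPrime (W.conductorNorm ℤ) W K 2 ℓ ∧
      Literature.NumberTheory.EllipticCurves.Rank1Residual.CMInert W ℓ)
    (hPn : ¬ ∃ Q : (W.baseChange (ringClassField K ιK n)).toAffine.Point, (2 : ℤ) • Q = d.derivedPoint) :
    ∑ q ∈ (NumberField.discr K).natAbs.primeFactors,
        ((if jacobiSym W.Δ.num q = -1 then 1 else 0) +
          (if jacobiSym W.Δ.num q = 1 ∧ Even (W.frobeniusTrace q) then 2 else 0)) ≤ 2 * M₀ + 1 := by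
  have hex := hX W hCM hin hρ hT K hK hoddK h3 hH hns₁ hns₂ Dt β ιK d₁ hy M₀ hdiv hndiv n d hn hKoly hPn
  have hle := two_pow_sum_defect_le_card_sha_two_baseChange_mul_two W hGZ hGZK hmod hMilneC hCM hin hρ hK hoddK hH Dt β ιK d₁ hy
  rw [hex, ← pow_succ] at hle
  exact (Nat.pow_le_pow_iff_right (by norm_num)).mp hle

/-- **In particular, with the trivial certificate `n = 1`: if `y_K ∉ 2E(K[1])` (`M₀ = 0`) then `Σ ≤ 1`** —
the crux asserts that a `2`-INDIVISIBLE Heegner point only occurs over Heegner fields whose discriminant has at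
most one prime `q` with `E(ℚ_q)[2] ≠ 0` (and then of order `2`).  Conditional on the crux and the four prints.
[cite: McCallumLMS1991, §5 Thm. 5.4] [cite: Kramer1981, Prop. 3] -/
theorem sum_defect_le_one_of_cmKolyvaginExact_of_not_two_dvd (hX : CMKolyvaginExactAtInertTwo)
    (hGZ : ∀ (N : ℕ) [NeZero N] (W : WeierstrassCurve ℚ) (K : Type) [Field K] [NumberField K], gross_zagier N W K)
    (hGZK : rank_eq_analyticRank_of_analyticRank_le_one) (hmod : hasEntireLFunction_rat)
    (hMilneC : Milne1972.bsdQuotient_baseChange_quadratic_anyModel)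
    [W.IsElliptic] [W.IsGloballyMinimal] [NeZero (W.conductorNorm ℤ)]
    (hCM : W.HasCM) (hin : Literature.NumberTheory.EllipticCurves.Rank1Residual.CMInert W 2)
    (hρ : W.HasSurjectiveModNGaloisRep 2) (hT : Odd W.tamagawaProduct) (hK : IsImaginaryQuadratic K)
    (hoddK : Odd (NumberField.discr K)) (h3 : NumberField.discr K ≠ -3)
    (hH : SatisfiesHeegnerHypothesis (W.conductorNorm ℤ) K)
    (hns₁ : ¬ IsSquare ((NumberField.discr K : ℚ) * -|W.Δ|)) (hns₂ : ¬ IsSquare ((NumberField.discr K : ℚ) * (-(2 * |W.Δ|))))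
    (Dt : ModularParametrizationData W (W.conductorNorm ℤ)) (β : ℤ) (ιK : K →+* ℂ) (d₁ : KolyvaginHeegnerData Dt β ιK 1)
    (hy : ¬ IsOfFinAddOrder d₁.derivedPoint)
    (hndiv : ¬ ∃ Q : (W.baseChange (ringClassField K ιK 1)).toAffine.Point, (2 : ℤ) • Q = d₁.derivedPoint) :
    ∑ q ∈ (NumberField.discr K).natAbs.primeFactors,
        ((if jacobiSym W.Δ.num q = -1 then 1 else 0) +
          (if jacobiSym W.Δ.num q = 1 ∧ Even (W.frobeniusTrace q) then 2 else 0)) ≤ 1 := by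
  have hdiv : ∃ Q : (W.baseChange (ringClassField K ιK 1)).toAffine.Point, ((2 ^ 0 : ℕ) : ℤ) • Q = d₁.derivedPoint :=
    ⟨d₁.derivedPoint, by rw [pow_zero, Nat.cast_one, one_smul]⟩
  have hndiv' : ¬ ∃ Q : (W.baseChange (ringClassField K ιK 1)).toAffine.Point,
      ((2 ^ (0 + 1) : ℕ) : ℤ) • Q = d₁.derivedPoint := by simpa using hndiv
  have h := sum_defect_le_of_cmKolyvaginExact W hX hGZ hGZK hmod hMilneC hCM hin hρ hT hK hoddK h3 hH hns₁ hns₂ Dt β ιK d₁ hy 0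
    hdiv hndiv' d₁ squarefree_one (fun ℓ hℓ ↦ absurd hℓ (by simp)) hndiv
  simpa using h

end Summit.BirchSwinnertonDyer.BirchSwinnertonDyer.Theorems.KolyvaginGenusTwo

end
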